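import Mathlib
import HarnessLib
import Summits.NavierStokesRegularity.NavierStokesRegularity.Theorems.HalfSpaceWindowDoorCirculationCarryingRigidityLedger

/-!
# Route `HalfSpaceWindowDoor`, crux `CirculationCarryingRigidity` (stmt-NavierStokesRegularity-25311) — line `ledger`, Step 5:
# the FULL LOG-ENERGY LAW `∫_{|c−z₀|<R} ∫_ρ^R Γ(r,c,s)² dr/r dc ≤ 4π K(C) R` — circulation is SCALE-SPARSE

LEAD ns-hsw-p1 g12 (cell pub-ns-dss), `--supports stmt-NavierStokesRegularity-25311 --as helper`.

Steps 1–2 (`…LogEnergy`, `…Ledger`) bound the circulation of ONE radius `ρ` against the window energy, using `Γ(r,c,s) ≥ Γ(ρ,c,s)` for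
`r ≥ ρ`.  Keeping the circulation of EVERY radius instead (the same planar polar coordinates and the same stacking) gives the parent
inequality, a logarithmic Sobolev-type ledger for the whole circulation landscape of a slice:

* `continuous_circ_uncurry` — `(r, c) ↦ Γ(r,c,s)` is jointly continuous (parametric interval integral);
* `annulusEnergy_ge_integral` — ONE PLANE: `(2π)⁻¹ ∫_{(ρ,R)} Γ(r,c,s)²/r dr ≤ ∫_{ρ<|ξ|<R} ‖v(s)(ξ,c)‖² dξ` (`ω₃ ≥ 0`, `0 < ρ`);
* `setIntegral_le_ball_of_planar_le` — STACKING, abstract form: any `ℓ(c) ≤ ∫_{ρ<|ξ|<R}‖v(s)(ξ,c)‖²`, integrable on the window,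
  has `∫_{(z₀−R,z₀+R)} ℓ ≤ ∫_{B((0,0,z₀),2R)} ‖v(s)‖²`;
* `exists_integral_integral_circ_sq_div_le` — **THE FULL LOG-ENERGY LAW (door class + closed hemisphere)**: `∃ K = K(C)`:
  `∫_{(z₀−R,z₀+R)} ( ∫_{(ρ,R)} Γ(r,c,s)²/r dr ) dc ≤ 4π K R` for all `s < 0`, `0 < ρ < R`, `z₀`.
  READING («SCALE-SPARSE CIRCULATION»): write `r = R e^{−u}`; the law says `∫_{window} ∫_0^{log(R/ρ)} Γ(Re^{−u},c,s)² du dc ≤ 4πKR`, so the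
  set of (plane, log-scale) pairs in a window of `2R` planes × `log(R/ρ)` scales on which `Γ ≥ γ` has measure `≤ 4πKR/γ²`: per plane, on
  average, AT MOST `2πK(C)/γ²` e-FOLDS OF SCALE carry circulation `≥ γ` — uniformly in `R`, `ρ`, `s`, the axis and the profile.  The rms law
  of `…Ledger` is the special case `Γ(r) ≥ Γ(ρ)`; the sublinear and filament laws are pointwise/ball shadows;
* `lintegral_loaded_radii_le`, `exists_lintegral_loaded_scales_le` — the Chebyshev form in log-scale: the `dc·dr/r`-measure of the
  (plane, radius) pairs of a window with `Γ(r,c,s) ≥ γ` is `≤ 4πKR/γ²`.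

WHAT THIS IS NOT: not a statement about Navier–Stokes regularity (Clay A); door statements are regularity CRITERIA about
HYPOTHETICAL blow-up profiles (KNSS ancient mild solutions); item 25311 stays OPEN at its research stub `stub_layerExclusion`.
-/

noncomputable section

-- the summit and its single sub-problem share the name (CONVENTIONS §1), as in every Theorems file
set_option linter.dupNamespace false

namespace Summit.NavierStokesRegularity.NavierStokesRegularity.Theorems.HalfSpaceWindowDoorCirculationCarryingRigidityLedgerScales

open Set Function Filter MeasureTheory Topology intervalIntegral Metric
open scoped InnerProductSpace RealInnerProductSpace
open Literature.Analysis Literature.Analysis.FluidPDE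
open Summit.NavierStokesRegularity.NavierStokesRegularity.Theorems.HalfSpaceWindowDoorCirculationCarryingRigidityDefs
  (planePt InDoorClass)
open Summit.NavierStokesRegularity.NavierStokesRegularity.Theorems.AxisTwistDoorAveragedConeLiouvilleDefs (cylPt eT e3 circ SignE3)
open Summit.NavierStokesRegularity.NavierStokesRegularity.Theorems.AveragedConeLiouville.CircMonotone (circ_nonneg circ_mono)
open Summit.NavierStokesRegularity.NavierStokesRegularity.Theorems.HalfSpaceWindowDoorCirculationCarryingRigidityPlanarEnergy
  (planePt_circlePt radial_energy_ge)
open Summit.NavierStokesRegularity.NavierStokesRegularity.Theorems.AxisTwistDoorAveragedConeLiouvilleCylFrame (continuous_cylPt_θ)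
open Summit.NavierStokesRegularity.NavierStokesRegularity.Theorems.AveragedConeLiouville.CircleStokes (cylPt_eq_smul_eR continuous_eT continuous_eR)
open Summit.NavierStokesRegularity.NavierStokesRegularity.Theorems.HalfSpaceWindowDoorCirculationCarryingRigidityConeFluxSubsolution
  (contDiff_one_slice)
open Summit.NavierStokesRegularity.NavierStokesRegularity.Theorems.HalfSpaceWindowDoorCirculationCarryingRigidityLogEnergy
  (measurableSet_annulus integrableOn_annulus circlePt_mem_annulus setIntegral_Ioc_eq_intervalIntegral planePt_mem_ball)
open Summit.NavierStokesRegularity.NavierStokesRegularity.Theorems.HalfSpaceWindowDoorCirculationCarryingRigidityLedger (exists_ledger)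

variable {v : ℝ → EuclideanSpace ℝ (Fin 3) → EuclideanSpace ℝ (Fin 3)}

/-! ### Joint continuity of the circulation landscape -/

/-- `(r, c) ↦ Γ(r,c,s)` is jointly continuous for a continuous slice. -/
theorem continuous_circ_uncurry {s : ℝ} (hv : Continuous (v s)) :
    Continuous fun p : ℝ × ℝ => circ v p.1 p.2 s := by
  unfold circ
  have hj : Continuous fun q : (ℝ × ℝ) × ℝ => cylPt q.1.1 q.2 q.1.2 := by
    have : (fun q : (ℝ × ℝ) × ℝ => cylPt q.1.1 q.2 q.1.2) =
        fun q : (ℝ × ℝ) × ℝ => q.1.1 • AxisTwistDoorAveragedConeLiouvilleDefs.eR q.2 + q.1.2 • e3 :=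
      funext fun q => cylPt_eq_smul_eR q.1.1 q.2 q.1.2
    rw [this]
    exact ((continuous_fst.comp continuous_fst).smul (continuous_eR.comp continuous_snd)).add
      ((continuous_snd.comp continuous_fst).smul continuous_const)
  have hf : Continuous (Function.uncurry fun (p : ℝ × ℝ) (θ : ℝ) => ⟪v s (cylPt p.1 θ p.2), eT θ⟫_ℝ * p.1) :=
    ((hv.comp hj).inner (continuous_eT.comp continuous_snd)).mul (continuous_fst.comp continuous_fst)
  exact intervalIntegral.continuous_parametric_intervalIntegral_of_continuous' hf 0 (2 * Real.pi)

/-- `r ↦ Γ(r,c,s)` is continuous. -/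
theorem continuous_circ_radius {s : ℝ} (hv : Continuous (v s)) (c : ℝ) : Continuous fun r : ℝ => circ v r c s :=
  (continuous_circ_uncurry hv).comp (Continuous.prodMk continuous_id continuous_const)

/-! ### §1  One plane, all radii -/

/-- **ONE PLANE, ALL RADII.**  For a `C¹` slice with `ω₃ ≥ 0` and `0 < ρ` (any `R`):
`(2π)⁻¹ ∫_{(ρ,R)} Γ(r,c,s)²/r dr ≤ ∫_{ρ<|ξ|<R} ‖v(s)(ξ,c)‖² dξ`. -/
theorem annulusEnergy_ge_integral {s c ρ R : ℝ} (hs : s < 0) (hv1 : ContDiff ℝ 1 (v s)) (hsign : SignE3 v)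
    (hρ : 0 < ρ) :
    (2 * Real.pi)⁻¹ * ∫ r in Ioo ρ R, circ v r c s ^ 2 / r ≤
      ∫ ξ in {ξ : EuclideanSpace ℝ (Fin 2) | ρ < ‖ξ‖ ∧ ‖ξ‖ < R}, ‖v s (planePt c ξ)‖ ^ 2 := by
  have hvc : Continuous (v s) := hv1.continuous
  set A : Set (EuclideanSpace ℝ (Fin 2)) := {ξ | ρ < ‖ξ‖ ∧ ‖ξ‖ < R} with hA
  set g : EuclideanSpace ℝ (Fin 2) → ℝ := A.indicator fun ξ => ‖v s (planePt c ξ)‖ ^ 2 with hg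
  have hgi : Integrable g := (integrable_indicator_iff (measurableSet_annulus ρ R)).2 (integrableOn_annulus hvc)
  have hg_nonneg : ∀ ξ, 0 ≤ g ξ := fun ξ => by
    simp only [hg]
    exact Set.indicator_nonneg (fun _ _ => by positivity) _
  have hpolar : ∫ ξ in A, ‖v s (planePt c ξ)‖ ^ 2 =
      ∫ r in Ioi (0 : ℝ), ∫ θ in Ioc (-Real.pi) Real.pi, r • g (circlePt r θ) := by
    rw [← MeasureTheory.integral_indicator (measurableSet_annulus ρ R)]
    exact integral_eq_integral_circlePt hgi
  rw [hpolar]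
  -- the radial lower bound, now with the circulation of the SAME radius
  set h : ℝ → ℝ := (Ioo ρ R).indicator fun r => circ v r c s ^ 2 / (2 * Real.pi * r) with hh
  have hinner : ∀ r ∈ Ioi (0 : ℝ), h r ≤ ∫ θ in Ioc (-Real.pi) Real.pi, r • g (circlePt r θ) := by
    intro r hr0
    have hr0' : 0 < r := hr0
    by_cases hr : r ∈ Ioo ρ R
    · have hgr : ∀ θ : ℝ, r • g (circlePt r θ) = r * ‖v s (cylPt r θ c)‖ ^ 2 := by
        intro θ
        have hmem : circlePt r θ ∈ A := circlePt_mem_annulus hr hρ.le θ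
        rw [smul_eq_mul, hg, Set.indicator_of_mem hmem, planePt_circlePt]
      simp_rw [hgr]
      rw [MeasureTheory.integral_const_mul, setIntegral_Ioc_eq_intervalIntegral, hh, Set.indicator_of_mem hr]
      have hγ0 : 0 ≤ circ v r c s := circ_nonneg v hv1 hsign hs hr0'.le c
      rcases hγ0.eq_or_lt with hγz | hγpos
      · rw [← hγz]
        simp only [ne_eq, OfNat.ofNat_ne_zero, not_false_eq_true, zero_pow, zero_div]
        exact mul_nonneg hr0'.le (intervalIntegral.integral_nonneg (by positivity) fun θ _ => by positivity)
      · exact radial_energy_ge hr0' hγpos hvc le_rfl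
    · rw [hh, Set.indicator_of_notMem hr]
      exact setIntegral_nonneg measurableSet_Ioc fun θ _ => by
        rw [smul_eq_mul]; exact mul_nonneg hr0'.le (hg_nonneg _)
  have houter : IntegrableOn (fun r : ℝ => ∫ θ in Ioc (-Real.pi) Real.pi, r • g (circlePt r θ)) (Ioi 0) := by
    have := (integrable_circlePt_smul hgi).integral_prod_left
    simpa [IntegrableOn] using this
  have hcontI : ContinuousOn (fun r : ℝ => circ v r c s ^ 2 / (2 * Real.pi * r)) (Icc ρ R) := by
    refine ((continuous_circ_radius hvc c).pow 2).continuousOn.div (continuousOn_const.mul continuousOn_id) fun r hr => ?_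
    have : 0 < r := hρ.trans_le hr.1
    positivity
  have hIoo : IntegrableOn (fun r : ℝ => circ v r c s ^ 2 / (2 * Real.pi * r)) (Ioo ρ R) :=
    (hcontI.integrableOn_compact isCompact_Icc).mono_set Ioo_subset_Icc_self
  have hhint : IntegrableOn h (Ioi 0) := by
    rw [hh, IntegrableOn, integrable_indicator_iff measurableSet_Ioo]
    exact hIoo.restrict
  have hmono : ∫ r in Ioi (0 : ℝ), h r ≤ ∫ r in Ioi (0 : ℝ), ∫ θ in Ioc (-Real.pi) Real.pi, r • g (circlePt r θ) :=
    setIntegral_mono_on hhint houter measurableSet_Ioi hinner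
  refine le_trans (le_of_eq ?_) hmono
  rw [hh, setIntegral_indicator measurableSet_Ioo,
    show Ioi (0 : ℝ) ∩ Ioo ρ R = Ioo ρ R from inter_eq_right.2 fun r hr => (hρ.trans hr.1 : (0 : ℝ) < r),
    ← MeasureTheory.integral_const_mul]
  refine setIntegral_congr_fun measurableSet_Ioo fun r _ => ?_
  rw [mul_comm (2 * Real.pi) r, ← div_div]
  ring

/-! ### §2  Stacking, abstract form -/

/-- **STACKING, abstract form.**  If `ℓ(c) ≤ ∫_{ρ<|ξ|<R} ‖v(s)(ξ,c)‖² dξ` for every `c` in the window `(z₀−R, z₀+R)` and `ℓ` is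
integrable there, then `∫_{(z₀−R,z₀+R)} ℓ ≤ ∫_{B((0,0,z₀), 2R)} ‖v(s)‖²` (`0 < ρ < R`; the cylinder lies in the ball). -/
theorem setIntegral_le_ball_of_planar_le {s z₀ ρ R : ℝ} (hvc : Continuous (v s))
    {ℓ : ℝ → ℝ} (hℓ : IntegrableOn ℓ (Ioo (z₀ - R) (z₀ + R)))
    (hle : ∀ c ∈ Ioo (z₀ - R) (z₀ + R), ℓ c ≤ ∫ ξ in {ξ : EuclideanSpace ℝ (Fin 2) | ρ < ‖ξ‖ ∧ ‖ξ‖ < R}, ‖v s (planePt c ξ)‖ ^ 2) :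
    ∫ c in Ioo (z₀ - R) (z₀ + R), ℓ c ≤ ∫ x in ball (planePt z₀ 0) (2 * R), ‖v s x‖ ^ 2 := by
  set I : Set ℝ := Ioo (z₀ - R) (z₀ + R) with hI
  set A : Set (EuclideanSpace ℝ (Fin 2)) := {ξ | ρ < ‖ξ‖ ∧ ‖ξ‖ < R} with hA
  set B : Set (EuclideanSpace ℝ (Fin 3)) := ball (planePt z₀ 0) (2 * R) with hB
  have hIm : MeasurableSet I := measurableSet_Ioo
  have hAm : MeasurableSet A := measurableSet_annulus ρ R
  have hBm : MeasurableSet B := measurableSet_ball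
  set F : EuclideanSpace ℝ (Fin 3) → ℝ := B.indicator fun x => ‖v s x‖ ^ 2 with hF
  have hFi : Integrable F := (integrable_indicator_iff hBm).2
    ((((hvc.norm.pow 2).continuousOn.integrableOn_compact (isCompact_closedBall _ _)).mono_set ball_subset_closedBall))
  have hF_nonneg : ∀ x, 0 ≤ F x := fun x => Set.indicator_nonneg (fun _ _ => by positivity) _
  set T : ℝ × EuclideanSpace ℝ (Fin 2) ≃ᵐ EuclideanSpace ℝ (Fin 3) :=
    ((MeasurableEquiv.prodCongr (MeasurableEquiv.refl ℝ) (MeasurableEquiv.toLp 2 (Fin 2 → ℝ)).symm).trans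
      (MeasurableEquiv.piFinSuccAbove (fun _ => ℝ) 2).symm).trans (MeasurableEquiv.toLp 2 (Fin 3 → ℝ)) with hT
  have hTmp : MeasurePreserving T (volume.prod volume) volume := by
    refine (MeasurePreserving.trans ?_ (volume_preserving_piFinSuccAbove (fun _ => ℝ) 2).symm).trans
      (PiLp.volume_preserving_toLp (Fin 3))
    have h2 : MeasurePreserving (MeasurableEquiv.toLp 2 (Fin 2 → ℝ)).symm volume volume :=
      EuclideanSpace.volume_preserving_symm_measurableEquiv_toLp (Fin 2)
    exact (MeasurePreserving.id volume).prod h2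
  have hTapply : ∀ c : ℝ, ∀ ξ : EuclideanSpace ℝ (Fin 2), T (c, ξ) = planePt c ξ := by
    intro c ξ
    ext i
    fin_cases i <;> rfl
  set f : ℝ × EuclideanSpace ℝ (Fin 2) → ℝ := fun p => ‖v s (planePt p.1 p.2)‖ ^ 2 with hf
  set G : ℝ × EuclideanSpace ℝ (Fin 2) → ℝ := (I ×ˢ A).indicator f with hG
  have hFT : Integrable (fun p => F (T p)) (volume.prod volume) :=
    (hTmp.integrable_comp_emb T.measurableEmbedding).2 hFi
  have hGeq : G = (I ×ˢ A).indicator fun p => F (T p) := by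
    funext p
    by_cases hp : p ∈ I ×ˢ A
    · have hmem : planePt p.1 p.2 ∈ B := planePt_mem_ball hp.2.2 hp.1
      rw [hG, Set.indicator_of_mem hp, Set.indicator_of_mem hp]
      change f p = F (T (p.1, p.2))
      rw [hTapply, hF, Set.indicator_of_mem hmem]
    · rw [hG, Set.indicator_of_notMem hp, Set.indicator_of_notMem hp]
  have hGi : Integrable G (volume.prod volume) := by
    rw [hGeq]; exact hFT.indicator (hIm.prod hAm)
  have hGle : ∀ p, G p ≤ F (T p) := by
    intro p
    rw [hGeq]
    by_cases hp : p ∈ I ×ˢ A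
    · rw [Set.indicator_of_mem hp]
    · rw [Set.indicator_of_notMem hp]; exact hF_nonneg _
  have h1 : ∫ p, G p ∂(volume.prod volume) ≤ ∫ x in B, ‖v s x‖ ^ 2 := by
    calc ∫ p, G p ∂(volume.prod volume)
        ≤ ∫ p, F (T p) ∂(volume.prod volume) := integral_mono hGi hFT hGle
      _ = ∫ x, F x := hTmp.integral_comp' F
      _ = ∫ x in B, ‖v s x‖ ^ 2 := MeasureTheory.integral_indicator hBm
  set h : ℝ → ℝ := fun c => ∫ ξ in A, ‖v s (planePt c ξ)‖ ^ 2 with hh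
  have hslice : (fun c => ∫ ξ, G (c, ξ)) = I.indicator h := by
    funext c
    by_cases hc : c ∈ I
    · rw [Set.indicator_of_mem hc, hh]
      have hGc : (fun ξ => G (c, ξ)) = A.indicator fun ξ => ‖v s (planePt c ξ)‖ ^ 2 := by
        funext ξ
        by_cases hξ : ξ ∈ A
        · rw [hG, Set.indicator_of_mem (mk_mem_prod hc hξ), Set.indicator_of_mem hξ]
        · have : (c, ξ) ∉ I ×ˢ A := fun hp => hξ hp.2
          rw [hG, Set.indicator_of_notMem this, Set.indicator_of_notMem hξ]
      change ∫ ξ, (fun ξ => G (c, ξ)) ξ = _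
      rw [hGc, MeasureTheory.integral_indicator hAm]
    · rw [Set.indicator_of_notMem hc]
      have hGc : (fun ξ => G (c, ξ)) = fun _ => 0 := by
        funext ξ
        have : (c, ξ) ∉ I ×ˢ A := fun hp => hc hp.1
        rw [hG, Set.indicator_of_notMem this]
      change ∫ ξ, (fun ξ => G (c, ξ)) ξ = 0
      rw [hGc, integral_zero]
  have h2 : ∫ p, G p ∂(volume.prod volume) = ∫ c in I, h c := by
    rw [integral_prod _ hGi, hslice, MeasureTheory.integral_indicator hIm]
  have hhI : IntegrableOn h I := by
    have := hGi.integral_prod_left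
    rw [hslice] at this
    exact (integrable_indicator_iff hIm).1 this
  have h3 : ∫ c in I, ℓ c ≤ ∫ c in I, h c := setIntegral_mono_on hℓ hhI hIm fun c hc => hle c hc
  exact h3.trans (h2 ▸ h1)

/-! ### §3  The full log-energy law -/

/-- **THE FULL LOG-ENERGY LAW (one slice under a ledger).**  For a `C¹` slice with `ω₃ ≥ 0` and the Leray-rate ledger
`∫_{B_r(x₀)}‖v(s)‖² ≤ K r`, for all `0 < ρ < R`, `z₀`:  `∫_{(z₀−R,z₀+R)} ( ∫_{(ρ,R)} Γ(r,c,s)²/r dr ) dc ≤ 4πKR`. -/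
theorem integral_integral_circ_sq_div_le {s : ℝ} (hs : s < 0) (hv1 : ContDiff ℝ 1 (v s)) (hsign : SignE3 v) {K : ℝ}
    (hK : ∀ (x₀ : EuclideanSpace ℝ (Fin 3)) (r : ℝ), 0 < r → ∫ x in ball x₀ r, ‖v s x‖ ^ 2 ≤ K * r)
    {ρ R : ℝ} (hρ : 0 < ρ) (hρR : ρ < R) (z₀ : ℝ) :
    ∫ c in Ioo (z₀ - R) (z₀ + R), (∫ r in Ioo ρ R, circ v r c s ^ 2 / r) ≤ 4 * Real.pi * K * R := by
  have hvc : Continuous (v s) := hv1.continuous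
  have hR : 0 < R := hρ.trans hρR
  have hπ : 0 < 2 * Real.pi := by positivity
  -- the inner integral as a parametric interval integral of a jointly continuous function ⇒ continuous in `c`
  set Φ : ℝ → ℝ → ℝ := fun c r => circ v r c s ^ 2 / max r ρ with hΦ
  have hΦc : Continuous (Function.uncurry Φ) := by
    refine ((continuous_circ_uncurry hvc).comp (continuous_snd.prodMk continuous_fst) |>.pow 2).div
      (continuous_snd.max continuous_const) fun p => ?_
    exact (lt_max_of_lt_right hρ).ne'
  have hinner_eq : ∀ c, ∫ r in Ioo ρ R, circ v r c s ^ 2 / r = ∫ r in ρ..R, Φ c r := by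
    intro c
    rw [intervalIntegral.integral_of_le hρR.le, integral_Ioc_eq_integral_Ioo]
    refine setIntegral_congr_fun measurableSet_Ioo fun r hr => ?_
    rw [hΦ]
    simp only [max_eq_left hr.1.le]
  have hcont : Continuous fun c => ∫ r in Ioo ρ R, circ v r c s ^ 2 / r := by
    simp_rw [hinner_eq]
    exact intervalIntegral.continuous_parametric_intervalIntegral_of_continuous' hΦc ρ R
  have hℓ : IntegrableOn (fun c => (2 * Real.pi)⁻¹ * ∫ r in Ioo ρ R, circ v r c s ^ 2 / r) (Ioo (z₀ - R) (z₀ + R)) :=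
    ((continuous_const.mul hcont).continuousOn.integrableOn_compact isCompact_Icc).mono_set Ioo_subset_Icc_self
  have h := setIntegral_le_ball_of_planar_le (z₀ := z₀) (ρ := ρ) (R := R) hvc hℓ
    fun c _ => annulusEnergy_ge_integral (c := c) (R := R) hs hv1 hsign hρ
  have h2 := h.trans (hK (planePt z₀ 0) (2 * R) (by positivity))
  rw [MeasureTheory.integral_const_mul, inv_mul_le_iff₀ hπ] at h2
  linarith

/-- **THE FULL LOG-ENERGY LAW (door class + closed hemisphere).**  There is `K = K(C) ≥ 0` such that every closed-hemisphere
door-class profile satisfies, for all `s < 0`, `0 < ρ < R`, `z₀`:  `∫_{(z₀−R,z₀+R)} ( ∫_{(ρ,R)} Γ(r,c,s)²/r dr ) dc ≤ 4πKR`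
— circulation is SCALE-SPARSE: per plane of any window, on average at most `2πK/γ²` e-folds of scale carry `Γ ≥ γ`. -/
theorem exists_integral_integral_circ_sq_div_le (C : ℝ) : ∃ K : ℝ, 0 ≤ K ∧
    ∀ v : ℝ → EuclideanSpace ℝ (Fin 3) → EuclideanSpace ℝ (Fin 3), InDoorClass C v → SignE3 v →
      ∀ s < 0, ∀ ρ R : ℝ, 0 < ρ → ρ < R → ∀ z₀ : ℝ,
        ∫ c in Ioo (z₀ - R) (z₀ + R), (∫ r in Ioo ρ R, circ v r c s ^ 2 / r) ≤ 4 * Real.pi * K * R := by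
  obtain ⟨K, hK0, hK⟩ := exists_ledger C
  exact ⟨K, hK0, fun v hv hsign s hs ρ R hρ hρR z₀ =>
    integral_integral_circ_sq_div_le hs (contDiff_one_slice hv hs) hsign (fun x₀ r hr => hK v hv s hs x₀ r hr) hρ hρR z₀⟩

/-! ### §4  Scale-sparse circulation (Chebyshev in log-scale) -/

/-- On one plane: the `dr/r`-measure of the radii in `(ρ,R)` carrying `Γ ≥ γ` is at most `γ⁻² ∫_{(ρ,R)} Γ²/r dr`. -/
theorem lintegral_loaded_radii_le {s c ρ R γ : ℝ} (hvc : Continuous (v s)) (hρ : 0 < ρ) (hγ : 0 < γ) :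
    ∫⁻ r in Ioo ρ R, {r : ℝ | γ ≤ circ v r c s}.indicator (fun r => ENNReal.ofReal r⁻¹) r ≤
      ENNReal.ofReal (γ⁻¹ ^ 2 * ∫ r in Ioo ρ R, circ v r c s ^ 2 / r) := by
  have hcont : ContinuousOn (fun r : ℝ => circ v r c s ^ 2 / r) (Icc ρ R) := by
    refine ((continuous_circ_radius hvc c).pow 2).continuousOn.div continuousOn_id fun r hr => ?_
    exact (hρ.trans_le hr.1).ne'
  have hint : IntegrableOn (fun r : ℝ => circ v r c s ^ 2 / r) (Ioo ρ R) :=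
    (hcont.integrableOn_compact isCompact_Icc).mono_set Ioo_subset_Icc_self
  have hnn : 0 ≤ᵐ[volume.restrict (Ioo ρ R)] fun r : ℝ => γ⁻¹ ^ 2 * (circ v r c s ^ 2 / r) := by
    refine (ae_restrict_iff' measurableSet_Ioo).2 (Eventually.of_forall fun r hr => ?_)
    have : 0 < r := hρ.trans hr.1
    positivity
  rw [← MeasureTheory.integral_const_mul, ofReal_integral_eq_lintegral_ofReal (hint.const_mul _) hnn]
  refine setLIntegral_mono' measurableSet_Ioo fun r hr => ?_
  have hr0 : 0 < r := hρ.trans hr.1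
  by_cases hmem : r ∈ {r : ℝ | γ ≤ circ v r c s}
  · rw [Set.indicator_of_mem hmem]
    refine ENNReal.ofReal_le_ofReal ?_
    have hγΓ : γ ≤ circ v r c s := hmem
    have h1 : (1 : ℝ) ≤ γ⁻¹ ^ 2 * circ v r c s ^ 2 := by
      rw [inv_pow, ← div_eq_inv_mul, one_le_div (by positivity)]
      exact pow_le_pow_left₀ hγ.le hγΓ 2
    calc r⁻¹ = 1 * r⁻¹ := (one_mul _).symm
      _ ≤ γ⁻¹ ^ 2 * circ v r c s ^ 2 * r⁻¹ := mul_le_mul_of_nonneg_right h1 (inv_nonneg.2 hr0.le)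
      _ = γ⁻¹ ^ 2 * (circ v r c s ^ 2 / r) := by rw [div_eq_mul_inv, mul_assoc]
  · rw [Set.indicator_of_notMem hmem]
    exact zero_le

/-- **SCALE-SPARSE CIRCULATION (door class + closed hemisphere).**  With `K = K(C)` of the full log-energy law: for all `s < 0`,
`0 < ρ < R`, `γ > 0`, `z₀`, the `dc · dr/r`-measure of the (plane, radius) pairs `(c, r) ∈ (z₀−R, z₀+R) × (ρ, R)` with `Γ(r,c,s) ≥ γ`
is `≤ 4πKR/γ²`; in log-scale `u = log r` this is Lebesgue measure, so per plane, on average over the window, at most `2πK/γ²` e-folds of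
scale carry circulation `≥ γ` — uniformly in `R`, `ρ`, `s`, the axis and the profile. -/
theorem exists_lintegral_loaded_scales_le (C : ℝ) : ∃ K : ℝ, 0 ≤ K ∧
    ∀ v : ℝ → EuclideanSpace ℝ (Fin 3) → EuclideanSpace ℝ (Fin 3), InDoorClass C v → SignE3 v →
      ∀ s < 0, ∀ ρ R : ℝ, 0 < ρ → ρ < R → ∀ γ : ℝ, 0 < γ → ∀ z₀ : ℝ,
        ∫⁻ c in Ioo (z₀ - R) (z₀ + R), ∫⁻ r in Ioo ρ R, {r : ℝ | γ ≤ circ v r c s}.indicator (fun r => ENNReal.ofReal r⁻¹) r ≤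
          ENNReal.ofReal (4 * Real.pi * K * R / γ ^ 2) := by
  obtain ⟨K, hK0, hK⟩ := exists_integral_integral_circ_sq_div_le C
  refine ⟨K, hK0, fun v hv hsign s hs ρ R hρ hρR γ hγ z₀ => ?_⟩
  have hvc : Continuous (v s) := (contDiff_one_slice hv hs).continuous
  have hmain := hK v hv hsign s hs ρ R hρ hρR z₀
  -- inner bound on every plane, then the outer integral of a continuous non-negative function
  set f : ℝ → ℝ := fun c => γ⁻¹ ^ 2 * ∫ r in Ioo ρ R, circ v r c s ^ 2 / r with hf
  have h1 : ∫⁻ c in Ioo (z₀ - R) (z₀ + R), ∫⁻ r in Ioo ρ R, {r : ℝ | γ ≤ circ v r c s}.indicator (fun r => ENNReal.ofReal r⁻¹) r ≤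
      ∫⁻ c in Ioo (z₀ - R) (z₀ + R), ENNReal.ofReal (f c) :=
    lintegral_mono fun c => lintegral_loaded_radii_le hvc hρ hγ
  refine h1.trans ?_
  -- continuity of the inner integral in `c` (as in `integral_integral_circ_sq_div_le`)
  set Φ : ℝ → ℝ → ℝ := fun c r => circ v r c s ^ 2 / max r ρ with hΦ
  have hΦc : Continuous (Function.uncurry Φ) := by
    refine ((continuous_circ_uncurry hvc).comp (continuous_snd.prodMk continuous_fst) |>.pow 2).div
      (continuous_snd.max continuous_const) fun p => ?_
    exact (lt_max_of_lt_right hρ).ne'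
  have hinner_eq : ∀ c, ∫ r in Ioo ρ R, circ v r c s ^ 2 / r = ∫ r in ρ..R, Φ c r := by
    intro c
    rw [intervalIntegral.integral_of_le hρR.le, integral_Ioc_eq_integral_Ioo]
    refine setIntegral_congr_fun measurableSet_Ioo fun r hr => ?_
    rw [hΦ]
    simp only [max_eq_left hr.1.le]
  have hcont : Continuous fun c => ∫ r in Ioo ρ R, circ v r c s ^ 2 / r := by
    simp_rw [hinner_eq]
    exact intervalIntegral.continuous_parametric_intervalIntegral_of_continuous' hΦc ρ R
  have hfint : IntegrableOn f (Ioo (z₀ - R) (z₀ + R)) :=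
    ((continuous_const.mul hcont).continuousOn.integrableOn_compact isCompact_Icc).mono_set Ioo_subset_Icc_self
  have hfnn : 0 ≤ᵐ[volume.restrict (Ioo (z₀ - R) (z₀ + R))] f :=
    Eventually.of_forall fun c => mul_nonneg (by positivity)
      (setIntegral_nonneg measurableSet_Ioo fun r hr => div_nonneg (sq_nonneg _) (hρ.trans hr.1).le)
  rw [← ofReal_integral_eq_lintegral_ofReal hfint hfnn]
  refine ENNReal.ofReal_le_ofReal ?_
  rw [hf, MeasureTheory.integral_const_mul]
  calc γ⁻¹ ^ 2 * ∫ c in Ioo (z₀ - R) (z₀ + R), ∫ r in Ioo ρ R, circ v r c s ^ 2 / r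
      ≤ γ⁻¹ ^ 2 * (4 * Real.pi * K * R) := mul_le_mul_of_nonneg_left hmain (by positivity)
    _ = 4 * Real.pi * K * R / γ ^ 2 := by rw [inv_pow, ← div_eq_inv_mul]

end Summit.NavierStokesRegularity.NavierStokesRegularity.Theorems.HalfSpaceWindowDoorCirculationCarryingRigidityLedgerScales

end
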